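/-
Copyright (c) 2026. Released under Apache 2.0 license as described in the file LICENSE.
Track B ∕ K2-LIT (cell `hodgecm-mathlib`, squad K2, ENGINE E1), crux h413 = `stmt-HodgeConjecture-24833`, route of record `HCCMUnconditional`.
Prover seat `hodgecm-mathlib-K2E3-p12` (g7).  Deal «P8 PROPER» (closer): the good test functions of record are SELF-CONVOLUTIONS `h = η ∗ η` (ruling 09:04:47Z ∕ 09:23:38Z, K1's ★ `hK1` head) — their elementary properties.
-/
import Summits.HodgeConjecture.HodgeConjecture.Theorems.K2E1TruncatedCuspDecayHNU2            -- ★ `orbitalSmoothing_self_eq_zero` (+ `orbitalSmoothing`)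
import Summits.HodgeConjecture.HodgeConjecture.Theorems.K2E1SphericalHeckeEigenSectionU2      -- ★ P5: `integral_flatSectionU_mul_mul_eq_cm`, `differentiable_integral_mul_borelHeight_cpow`
import Literature.NumberTheory.Automorphic.UnitaryGroupTruncatedTraceClassElliptic            -- ★ `t2Space_quasiSplitAdelic`, `secondCountableTopology_quasiSplitAdelic`
import Mathlib.MeasureTheory.Integral.Bochner.ContinuousLinearMap
import HarnessLib

/-!
# K2·E1 — `K2E1BLSelfConvolutionU2`: THE SELF-CONVOLUTION `h = η ∗ η`, `h(y) = ∫ η(g) η(g⁻¹y) dνG(g)` (`orbitalSmoothing νG η η`) OF A COMPACTLY SUPPORTED CONTINUOUS `η` ON `U(J_N)(𝔸)`: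
# compact support, continuity, left-`K`-invariance, symmetry `h(y⁻¹) = h(y)` for symmetric `η`, reality and non-negativity, `h(1) ≠ 0`, and ITS SPHERICAL TRANSFORM `ĥ(z) = η̂(z)²`
# [arXiv:1911.02342, §4 p. 9 «for every s there exists h ∈ C_c^∞(G//K) with ĥ(s) ≠ 0»; Langlands LNM 544 §6]

Track B ∕ K2-LIT, crux h413 = `stmt-HodgeConjecture-24833`, route of record `HCCMUnconditional`; cell `hodgecm-mathlib`, squad K2, ENGINE E1 (campaign EIS-R7-BL-SPH-2, P8 closer: the test
functions fed to ★ K1 `exists_forall_ae_norm_rightConvFun_le_of_unfolding` (h = `orbitalSmoothing νG η η`), ★ S1, ★ P6′ `hunq_of_memLp_two` (symmetric, real, `h(1) ≠ 0`) and ★ P8 §2 (cover by the `ĥ_i`)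
must be the SAME functions — this file supplies their properties).  Prover seat `hodgecm-mathlib-K2E3-p12` (g7).  THEOREMS ONLY (no `def`, no `instance`, no notation, no named-fact hypothesis,
no `sorry`); lane `--supports stmt-HodgeConjecture-24833 --as helper` (count-neutral).  Closes no socket.  §1–§3 RANK-GENERIC; §4 (`ĥ = η̂²`) over the CM pair (★ Iwasawa section identity).
§1 `tsupport_selfConv_subset`, `hasCompactSupport_selfConv`, `continuous_selfConv`, `integrable_selfConv`.  §2 `selfConv_mul_left` (left-`K`-invariance from that of `η`), `selfConv_inv` (symmetry),
`conj_selfConv`, `selfConv_re_nonneg`, `selfConv_one_ne_zero`.  §3 `exists_ne_zero_of_integral_ne_zero`.  §4 **`integral_selfConv_mul_borelHeight_cpow_cm`** (`ĥ(z) = η̂(z)·η̂(z)`, Fubini + ★ P5 section identity).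
HONEST LABEL: HC_CM is proved only modulo the 7 printed citations (2 remaining named inputs: hLiu418 = `stmt-HodgeConjecture-24832`, h413 = `stmt-HodgeConjecture-24833`) until rung 0
closes; this file asserts no named fact and closes no socket.
References: [BernsteinLapid2019] J. Bernstein, E. Lapid, *On the meromorphic continuation of Eisenstein series*, arXiv:1911.02342 (JAMS 37 (2024), doi:10.1090/jams/1020), §4 p. 9 · [Langlands1976]
R. P. Langlands, *On the Functional Equations Satisfied by Eisenstein Series*, LNM 544, §6.
-/

set_option autoImplicit false
-- the mandated namespace repeats the single-problem summit's segment (`HodgeConjecture.HodgeConjecture`)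
set_option linter.dupNamespace false

noncomputable section

open MeasureTheory Filter Topology Set NumberField Function
open scoped NNReal ENNReal Pointwise ComplexConjugate
open Literature.NumberTheory.Automorphic Literature.NumberTheory.Automorphic.UnitaryGroup AdelicGroupData
open Summit.HodgeConjecture.HodgeConjecture.Cruxes.H413.K2E1BorelEisensteinU
open Summit.HodgeConjecture.HodgeConjecture.Cruxes.H413.K2E1TruncatedCuspDecayHNU2 (orbitalSmoothing_self_eq_zero)
open Summit.HodgeConjecture.HodgeConjecture.Cruxes.H413.K2E1SphericalHeckeEigenSectionU2 (integral_flatSectionU_mul_mul_eq_cm)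

namespace Summit.HodgeConjecture.HodgeConjecture.Cruxes.H413.K2E1BLSelfConvolutionU2

section Generic

variable {F E : Type} [Field F] [NumberField F] [Field E] [NumberField E] [Algebra F E] {c : E ≃ₐ[F] E} {N : ℕ} [NeZero N]
variable [MeasurableSpace (quasiSplit F E c N).Adelic] [BorelSpace (quasiSplit F E c N).Adelic]

/-! ## §1 Support, continuity, integrability -/

omit [NeZero N] [BorelSpace (quasiSplit F E c N).Adelic] in
/-- The self-convolution is supported in `tsupport η · tsupport η`. [folklore] -/
theorem tsupport_selfConv_subset (νG : Measure (quasiSplit F E c N).Adelic) {η : (quasiSplit F E c N).Adelic → ℂ} (hηs : HasCompactSupport η) :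
    tsupport (fun y => orbitalSmoothing νG η η y) ⊆ tsupport η * tsupport η := by
  haveI := t2Space_quasiSplitAdelic (F := F) (E := E) (c := c) (N := N)
  refine closure_minimal (fun y hy => ?_) ((hηs.mul hηs).isClosed)
  by_contra h
  exact hy (orbitalSmoothing_self_eq_zero (ν := νG) h)

omit [NeZero N] [BorelSpace (quasiSplit F E c N).Adelic] in
/-- The self-convolution of a compactly supported `η` has compact support. [folklore] -/
theorem hasCompactSupport_selfConv (νG : Measure (quasiSplit F E c N).Adelic) {η : (quasiSplit F E c N).Adelic → ℂ} (hηs : HasCompactSupport η) :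
    HasCompactSupport (fun y => orbitalSmoothing νG η η y) :=
  (hηs.mul hηs).of_isClosed_subset (isClosed_tsupport _) (tsupport_selfConv_subset νG hηs)

omit [NeZero N] in
/-- The self-convolution of a continuous compactly supported `η` is continuous (dominated convergence: `|η(g)η(g⁻¹y)| ≤ ‖η‖_∞|η(g)|`). [folklore] -/
theorem continuous_selfConv (νG : Measure (quasiSplit F E c N).Adelic) [IsFiniteMeasureOnCompacts νG] {η : (quasiSplit F E c N).Adelic → ℂ} (hηc : Continuous η)
    (hηs : HasCompactSupport η) : Continuous fun y => orbitalSmoothing νG η η y := by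
  haveI := secondCountableTopology_quasiSplitAdelic (F := F) (E := E) (c := c) (N := N)
  obtain ⟨M, hM⟩ := hηc.bounded_above_of_compact_support hηs
  unfold orbitalSmoothing
  refine continuous_of_dominated (F := fun (y g : (quasiSplit F E c N).Adelic) => η g • η (g⁻¹ • y)) (bound := fun g => ‖η g‖ * M)
    (fun y => ?_) (fun y => Eventually.of_forall fun g => ?_) ?_ (Eventually.of_forall fun g => ?_)
  · exact hηc.aestronglyMeasurable.smul ((hηc.comp (continuous_inv.smul continuous_const)).aestronglyMeasurable)
  · rw [norm_smul]
    exact mul_le_mul_of_nonneg_left (hM _) (norm_nonneg _)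
  · exact (hηc.norm.mul continuous_const).integrable_of_hasCompactSupport hηs.norm.mul_right
  · exact (continuous_const : Continuous fun _ : (quasiSplit F E c N).Adelic => η g).smul
      (hηc.comp ((continuous_const : Continuous fun _ : (quasiSplit F E c N).Adelic => g⁻¹).smul continuous_id))

omit [NeZero N] in
/-- The self-convolution of a continuous compactly supported `η` is integrable against any measure finite on compacta. [folklore] -/
theorem integrable_selfConv (νG : Measure (quasiSplit F E c N).Adelic) [IsFiniteMeasureOnCompacts νG] (μ : Measure (quasiSplit F E c N).Adelic) [IsFiniteMeasureOnCompacts μ]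
    {η : (quasiSplit F E c N).Adelic → ℂ} (hηc : Continuous η) (hηs : HasCompactSupport η) : Integrable (fun y => orbitalSmoothing νG η η y) μ :=
  (continuous_selfConv νG hηc hηs).integrable_of_hasCompactSupport (hasCompactSupport_selfConv νG hηs)

/-! ## §2 Invariance, symmetry, reality, positivity -/

omit [NeZero N] in
/-- **Left-`K`-invariance**: if `η(k·x) = η(x)` for `k` in a set `K`, then so does `η ∗ η` (substitute `g ↦ k·g`, left Haar invariance). [folklore] -/
theorem selfConv_mul_left (νG : Measure (quasiSplit F E c N).Adelic) [νG.IsMulLeftInvariant] {η : (quasiSplit F E c N).Adelic → ℂ} {K : Set (quasiSplit F E c N).Adelic}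
    (hK : ∀ k ∈ K, ∀ x, η (k * x) = η x) {k : (quasiSplit F E c N).Adelic} (hk : k ∈ K) (y : (quasiSplit F E c N).Adelic) :
    orbitalSmoothing νG η η (k * y) = orbitalSmoothing νG η η y := by
  unfold orbitalSmoothing
  rw [← integral_mul_left_eq_self (fun g => η g • η (g⁻¹ • (k * y))) k]
  refine integral_congr_ae (Eventually.of_forall fun g => ?_)
  simp only [smul_eq_mul, hK k hk, _root_.mul_inv_rev, mul_assoc, inv_mul_cancel_left]

omit [NeZero N] in
/-- **Symmetry**: for symmetric `η` (`η(g⁻¹) = η(g)`) the self-convolution is symmetric, `h(y⁻¹) = h(y)`. [folklore] -/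
theorem selfConv_inv (νG : Measure (quasiSplit F E c N).Adelic) [νG.IsMulLeftInvariant] {η : (quasiSplit F E c N).Adelic → ℂ} (hsymm : ∀ g, η g⁻¹ = η g)
    (y : (quasiSplit F E c N).Adelic) : orbitalSmoothing νG η η y⁻¹ = orbitalSmoothing νG η η y := by
  unfold orbitalSmoothing
  -- `∫ η(g) η(g⁻¹y⁻¹) = ∫ η(g) η(yg)` (symmetry) `= ∫ η(y⁻¹g) η(g)` (left invariance) `= ∫ η(g) η(g⁻¹y)` (symmetry)
  have h1 : (fun g => η g • η (g⁻¹ • y⁻¹)) = fun g => η g • η (y * g) := funext fun g => by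
    simp only [smul_eq_mul]
    rw [← hsymm (y * g), _root_.mul_inv_rev]
  rw [h1, ← integral_mul_left_eq_self (fun g => η g • η (y * g)) y⁻¹]
  refine integral_congr_ae (Eventually.of_forall fun g => ?_)
  simp only [smul_eq_mul, mul_inv_cancel_left]
  rw [← hsymm (y⁻¹ * g), _root_.mul_inv_rev, inv_inv, mul_comm]

omit [NeZero N] [BorelSpace (quasiSplit F E c N).Adelic] in
/-- **Reality**: if `η` is real (`conj η = η`) then so is `η ∗ η`. [folklore] -/
theorem conj_selfConv (νG : Measure (quasiSplit F E c N).Adelic) {η : (quasiSplit F E c N).Adelic → ℂ} (hreal : ∀ g, conj (η g) = η g) (y : (quasiSplit F E c N).Adelic) :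
    conj (orbitalSmoothing νG η η y) = orbitalSmoothing νG η η y := by
  unfold orbitalSmoothing
  rw [← integral_conj]
  refine integral_congr_ae (Eventually.of_forall fun g => ?_)
  simp only [smul_eq_mul, map_mul, hreal]

omit [NeZero N] [BorelSpace (quasiSplit F E c N).Adelic] in
/-- **Non-negativity**: for `η = (η₀ : ℝ) ≥ 0` the self-convolution has non-negative real part (indeed is a non-negative real). [folklore] -/
theorem selfConv_re_nonneg (νG : Measure (quasiSplit F E c N).Adelic) {η₀ : (quasiSplit F E c N).Adelic → ℝ} (h0 : ∀ g, 0 ≤ η₀ g) (y : (quasiSplit F E c N).Adelic) :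
    0 ≤ (orbitalSmoothing νG (fun g => ((η₀ g : ℝ) : ℂ)) (fun g => ((η₀ g : ℝ) : ℂ)) y).re := by
  unfold orbitalSmoothing
  have h1 : (fun g => (((η₀ g : ℝ) : ℂ)) • (((η₀ (g⁻¹ • y) : ℝ) : ℂ))) = fun g => (((η₀ g * η₀ (g⁻¹ • y) : ℝ)) : ℂ) := funext fun g => by
    simp only [smul_eq_mul, Complex.ofReal_mul]
  rw [h1, integral_complex_ofReal, Complex.ofReal_re]
  exact integral_nonneg fun g => mul_nonneg (h0 _) (h0 _)

omit [NeZero N] in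
/-- **`(η ∗ η)(1) ≠ 0`** for a real non-negative continuous compactly supported `η ≢ 0` (`(η ∗ η)(1) = ∫ η(g)η(g⁻¹) = ∫ η² > 0` for symmetric `η`). [folklore] -/
theorem selfConv_one_ne_zero (νG : Measure (quasiSplit F E c N).Adelic) [IsFiniteMeasureOnCompacts νG] [νG.IsOpenPosMeasure] {η₀ : (quasiSplit F E c N).Adelic → ℝ}
    (hηc : Continuous η₀) (hηs : HasCompactSupport η₀) (h0 : ∀ g, 0 ≤ η₀ g) (hsymm : ∀ g, η₀ g⁻¹ = η₀ g) {g₀ : (quasiSplit F E c N).Adelic} (hg₀ : η₀ g₀ ≠ 0) :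
    orbitalSmoothing νG (fun g => ((η₀ g : ℝ) : ℂ)) (fun g => ((η₀ g : ℝ) : ℂ)) 1 ≠ 0 := by
  unfold orbitalSmoothing
  have h1 : (fun g => (((η₀ g : ℝ) : ℂ)) • (((η₀ (g⁻¹ • (1 : (quasiSplit F E c N).Adelic)) : ℝ) : ℂ))) = fun g => (((η₀ g * η₀ g : ℝ)) : ℂ) := funext fun g => by
    simp only [smul_eq_mul, mul_one, hsymm, Complex.ofReal_mul]
  rw [h1, integral_complex_ofReal, Complex.ofReal_ne_zero]
  have hint : Integrable (fun g => η₀ g * η₀ g) νG := (hηc.mul hηc).integrable_of_hasCompactSupport (hηs.mul_right)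
  have hpos : 0 < ∫ g, η₀ g * η₀ g ∂νG := by
    rw [integral_pos_iff_support_of_nonneg (fun g => mul_nonneg (h0 g) (h0 g)) hint]
    have hopen : IsOpen (Function.support fun g => η₀ g * η₀ g) := (hηc.mul hηc).isOpen_support
    exact hopen.measure_pos νG ⟨g₀, by simp only [Function.mem_support, ne_eq, mul_eq_zero, or_self]; exact hg₀⟩
  exact hpos.ne'

/-! ## §3 A non-zero transform forces `η ≢ 0` -/

omit [BorelSpace (quasiSplit F E c N).Adelic] in
/-- If `∫ η·H^z ≠ 0` then `η(g₀) ≠ 0` for some `g₀`. [folklore] -/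
theorem exists_ne_zero_of_integral_ne_zero (νG : Measure (quasiSplit F E c N).Adelic) {η₀ : (quasiSplit F E c N).Adelic → ℝ} {z : ℂ}
    (h : (∫ x, ((η₀ x : ℝ) : ℂ) * (((borelHeight x : ℝ≥0) : ℝ) : ℂ) ^ z ∂νG) ≠ 0) : ∃ g₀, η₀ g₀ ≠ 0 := by
  by_contra hall
  simp only [not_exists, not_not] at hall
  exact h (by simp only [hall, Complex.ofReal_zero, zero_mul, integral_zero])

end Generic

/-! ## §4 The spherical transform of `η ∗ η` is `η̂²` (CM pair, any rank `N`) -/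

section CM

variable (L : Type) [Field L] [NumberField L] [IsCMField L] {N : ℕ} [NeZero N]
  [MeasurableSpace (quasiSplit (↥(maximalRealSubfield L)) L (IsCMField.complexConj L) N).Adelic] [BorelSpace (quasiSplit (↥(maximalRealSubfield L)) L (IsCMField.complexConj L) N).Adelic]

/-- **`(η ∗ η)^(z) = η̂(z)·η̂(z)`** for a left-`K_U`-invariant continuous compactly supported `η` on `U(J_N)(𝔸_{L⁺})` and a (left) Haar measure: Fubini over the compactly supported continuous
integrand `η(g)η(g⁻¹y)H(y)^z`, the substitution `y ↦ gy`, and the ★ Iwasawa section identity `∫ H(gy)^z η(y) dy = η̂(z)·H(g)^z`. [cite: Langlands1976, §6 p. 167] [cite: BernsteinLapid2019, §4 p. 9] -/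
theorem integral_selfConv_mul_borelHeight_cpow_cm (νG : Measure (quasiSplit (↥(maximalRealSubfield L)) L (IsCMField.complexConj L) N).Adelic) [νG.IsHaarMeasure] [SFinite νG]
    {η : (quasiSplit (↥(maximalRealSubfield L)) L (IsCMField.complexConj L) N).Adelic → ℂ}
    (hK : ∀ k : (quasiSplit (↥(maximalRealSubfield L)) L (IsCMField.complexConj L) N).Adelic,
      adelicVal (↥(maximalRealSubfield L)) L (IsCMField.complexConj L) N ((StdForm.antidiagonal N).over L) k ∈ standardMaximalCompactGL N L → ∀ x, η (k * x) = η x)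
    (hηc : Continuous η) (hηs : HasCompactSupport η) (z : ℂ) :
    (∫ y, orbitalSmoothing νG η η y * (((borelHeight y : ℝ≥0) : ℝ) : ℂ) ^ z ∂νG) =
      (∫ x, η x * (((borelHeight x : ℝ≥0) : ℝ) : ℂ) ^ z ∂νG) * (∫ x, η x * (((borelHeight x : ℝ≥0) : ℝ) : ℂ) ^ z ∂νG) := by
  haveI := secondCountableTopology_quasiSplitAdelic (F := ↥(maximalRealSubfield L)) (E := L) (c := IsCMField.complexConj L) (N := N)
  -- the integrand on `G × G` and its integrability (continuous, compact support)
  have hHc : Continuous fun y : (quasiSplit (↥(maximalRealSubfield L)) L (IsCMField.complexConj L) N).Adelic => (((borelHeight y : ℝ≥0) : ℝ) : ℂ) ^ z :=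
    K2E1SphericalHeckeEigenSectionU2.continuous_borelHeight_cpow z
  have hFc : Continuous fun p : (quasiSplit (↥(maximalRealSubfield L)) L (IsCMField.complexConj L) N).Adelic × (quasiSplit (↥(maximalRealSubfield L)) L (IsCMField.complexConj L) N).Adelic =>
      η p.1 * η (p.1⁻¹ * p.2) * (((borelHeight p.2 : ℝ≥0) : ℝ) : ℂ) ^ z :=
    ((hηc.comp continuous_fst).mul (hηc.comp ((continuous_fst.inv).mul continuous_snd))).mul (hHc.comp continuous_snd)
  have hFs : HasCompactSupport fun p : (quasiSplit (↥(maximalRealSubfield L)) L (IsCMField.complexConj L) N).Adelic × (quasiSplit (↥(maximalRealSubfield L)) L (IsCMField.complexConj L) N).Adelic =>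
      η p.1 * η (p.1⁻¹ * p.2) * (((borelHeight p.2 : ℝ≥0) : ℝ) : ℂ) ^ z := by
    refine HasCompactSupport.of_support_subset_isCompact (hηs.prod (hηs.mul hηs)) fun p hp => ?_
    simp only [Function.mem_support, ne_eq, mul_eq_zero, not_or] at hp
    refine ⟨subset_tsupport _ hp.1.1, ?_⟩
    have h2 : p.2 = p.1 * (p.1⁻¹ * p.2) := by rw [mul_inv_cancel_left]
    rw [h2]
    exact Set.mul_mem_mul (subset_tsupport _ hp.1.1) (subset_tsupport _ hp.1.2)
  have hFi : Integrable (fun p : (quasiSplit (↥(maximalRealSubfield L)) L (IsCMField.complexConj L) N).Adelic × (quasiSplit (↥(maximalRealSubfield L)) L (IsCMField.complexConj L) N).Adelic =>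
      η p.1 * η (p.1⁻¹ * p.2) * (((borelHeight p.2 : ℝ≥0) : ℝ) : ℂ) ^ z) (νG.prod νG) := hFc.integrable_of_hasCompactSupport hFs
  -- LHS as an iterated integral in the order `∫ y ∫ g`
  have hL : (∫ y, orbitalSmoothing νG η η y * (((borelHeight y : ℝ≥0) : ℝ) : ℂ) ^ z ∂νG) =
      ∫ y, ∫ g, η g * η (g⁻¹ * y) * (((borelHeight y : ℝ≥0) : ℝ) : ℂ) ^ z ∂νG ∂νG := by
    refine integral_congr_ae (Eventually.of_forall fun y => ?_)
    simp only [orbitalSmoothing, smul_eq_mul, ← integral_mul_const]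
  rw [hL, ← integral_integral_swap hFi]
  -- inner integral: substitution `y ↦ g y` and the section identity
  have hinner : ∀ g : (quasiSplit (↥(maximalRealSubfield L)) L (IsCMField.complexConj L) N).Adelic,
      (∫ y, η g * η (g⁻¹ * y) * (((borelHeight y : ℝ≥0) : ℝ) : ℂ) ^ z ∂νG) =
        η g * (((borelHeight g : ℝ≥0) : ℝ) : ℂ) ^ z * ∫ x, η x * (((borelHeight x : ℝ≥0) : ℝ) : ℂ) ^ z ∂νG := by
    intro g
    have h1 : (∫ y, η g * η (g⁻¹ * y) * (((borelHeight y : ℝ≥0) : ℝ) : ℂ) ^ z ∂νG) = ∫ y, η g * η y * (((borelHeight (g * y) : ℝ≥0) : ℝ) : ℂ) ^ z ∂νG := by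
      rw [← integral_mul_left_eq_self (fun y => η g * η (g⁻¹ * y) * (((borelHeight y : ℝ≥0) : ℝ) : ℂ) ^ z) g]
      simp only [inv_mul_cancel_left]
    have h2 := integral_flatSectionU_mul_mul_eq_cm L (N := N) νG hK 1 z g
    simp only [flatSectionU_apply, one_mul] at h2
    rw [h1]
    calc (∫ y, η g * η y * (((borelHeight (g * y) : ℝ≥0) : ℝ) : ℂ) ^ z ∂νG)
        = η g * ∫ y, (((borelHeight (g * y) : ℝ≥0) : ℝ) : ℂ) ^ z * η y ∂νG := by
          rw [← integral_const_mul]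
          refine integral_congr_ae (Eventually.of_forall fun y => ?_)
          ring
      _ = η g * ((∫ x, η x * (((borelHeight x : ℝ≥0) : ℝ) : ℂ) ^ z ∂νG) * (((borelHeight g : ℝ≥0) : ℝ) : ℂ) ^ z) := by rw [h2]
      _ = η g * (((borelHeight g : ℝ≥0) : ℝ) : ℂ) ^ z * ∫ x, η x * (((borelHeight x : ℝ≥0) : ℝ) : ℂ) ^ z ∂νG := by ring
  simp_rw [hinner]
  rw [integral_mul_const]

end CM

end Summit.HodgeConjecture.HodgeConjecture.Cruxes.H413.K2E1BLSelfConvolutionU2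

end
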